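import Summits.RiemannHypothesis.RiemannHypothesis.Theorems.WeilWindowFlowGronwallLeakageMaximalFlow
import Summits.RiemannHypothesis.RiemannHypothesis.Theorems.WeilWindowFlowGronwallLeakageStrictAnti
import Summits.RiemannHypothesis.RiemannHypothesis.Theorems.GronwallLeakage.Negative.Structure
import HarnessLib

/-!
# DECOMPOSITION CENSUS (gen 1) — crux `WeilWindowFlow.GronwallLeakage` (stmt-RiemannHypothesis-1037)

Typed forms of the decomposition families re-examined by the crux-strategist re-arm
planner-cstrat-stmt-RiemannHypothesis-1037-r1-0 (2026-08-17) against the BC2-redirect test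
(a) every piece load-bearing · (b) assembly PROVED and non-trivial · (c) no piece equivalent to the
crux `X` or to the Statement.  Companion to `STRATEGY-CENSUS.md` §"Decomposition re-exam (gen 1)"
and to the gen-0 sheet `StrategyCensus.lean` (families D1–D5 there).  Nothing here is a registered
line and no item is filed from it: every assembly below is sorry-free, and for each family the
theorem or the docstring names the piece that is the crux / the summit in substance.

* §F2  head rung × tail leakage: `TailLeakage a₁ ↔ (WeilPositivityOn a₁ → RH)` is PROVED here
  (`tailLeakage_iff_head_imp_rh`) — the split is `S ⟸ H ∧ (H → S)` written in flow language.
* §R   generic "restriction of Weil's criterion to a class `S` of test functions":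
  `RestrictionReachesBottom S ∧ RestrictedWeilPositivity S → UniformWeilPositivity → X`
  (sorry-free), with the instances positive cone (Perron–Frobenius, §F5) and even sector (§F4);
  the second piece is RH by the Landau / bounded-power-sum costume lemma (census L1; stated as
  `PosConeCostume`, `EvenSectorCostume`, not proved here).
-/

set_option linter.dupNamespace false

noncomputable section

open MeasureTheory Set Filter Topology
open Literature.NumberTheory.LFunctions
open Summit.RiemannHypothesis.RiemannHypothesis.Theses.WeilWindowFlow (GronwallLeakage)
open Summit.RiemannHypothesis.RiemannHypothesis.Theorems.WeilWindowFlowGronwallLeakage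
open Summit.RiemannHypothesis.Cruxes.GronwallLeakage.Negative

namespace Summit.RiemannHypothesis.RiemannHypothesis.Cruxes.GronwallLeakage.DecompCensus

local notation "ε" => weilGroundEnergy

/-! ## §0 Criteria for the crux used by every assembly below -/

/-- `ε ≥ 0` at every window gives the crux (Yoshida's criterion + `X ↔ RH`, both landed). -/
theorem gronwallLeakage_of_forall_nonneg (h : ∀ a : ℝ, 0 < a → 0 ≤ ε a) : GronwallLeakage :=
  gronwallLeakage_iff_riemannHypothesis.2
    (riemannHypothesis_iff_forall_weilPositivityOn.2 fun a ha ↦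
      (weilGroundEnergy_nonneg_iff_holds ha).1 (h a ha))

/-- Weil positivity at every window gives the crux (item 0098 ⟹ 1037, landed iff). -/
theorem gronwallLeakage_of_uniformWeilPositivity (h : UniformWeilPositivity) : GronwallLeakage :=
  gronwallLeakage_iff_uniformWeilPositivity.2 h

/-! ## §F2 Head rung × tail leakage (the exempt-46 "fix" shape)

`HeadRung a₁ := WeilPositivityOn a₁` (a finite certificate, RH-implied, strictly weaker than RH) and
the crux's own law restricted to base windows `b ≥ a₁`. The assembly is genuine Grönwall transport
(not a one-liner), but the tail is PROVABLY `HeadRung a₁ → RH`: the split is modus ponens. -/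

/-- Head: Weil positivity on the one window `[-a₁, a₁]`. -/
def HeadRung (a₁ : ℝ) : Prop := WeilPositivityOn a₁

/-- Tail: the Grönwall leakage law of the crux, for base windows `b ≥ a₁` only. -/
def TailLeakage (a₁ : ℝ) : Prop :=
  ∃ C : ℝ → ℝ, ∀ b a : ℝ, a₁ ≤ b → b ≤ a →
    IntervalIntegrable C volume b a ∧ ε b * Real.exp (-(∫ x in b..a, C x)) ≤ ε a

/-- **Assembly F2 (sorry-free, non-trivial as Lean):** head + tail ⟹ crux. Positivity on `(0, a₁]` from
the head by monotonicity of the cones, on `[a₁, ∞)` by transporting `ε a₁ ≥ 0` with the tail law. -/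
theorem gronwallLeakage_of_head_tail {a₁ : ℝ} (ha₁ : 0 < a₁) (hH : HeadRung a₁)
    (hT : TailLeakage a₁) : GronwallLeakage := by
  refine gronwallLeakage_of_forall_nonneg fun a ha ↦ ?_
  by_cases hle : a ≤ a₁
  · exact (weilGroundEnergy_nonneg_iff_holds ha).2 (WeilPositivityOn.mono hle hH)
  · have hlt : a₁ ≤ a := le_of_lt (lt_of_not_ge hle)
    have h0 : 0 ≤ ε a₁ := (weilGroundEnergy_nonneg_iff_holds ha₁).2 hH
    obtain ⟨C, hC⟩ := hT
    exact le_trans (mul_nonneg h0 (Real.exp_pos _).le) (hC a₁ a le_rfl hlt).2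

/-- `X` itself gives the tail at every base (restriction of the witness). -/
theorem tailLeakage_of_gronwallLeakage {a₁ : ℝ} (ha₁ : 0 < a₁) (hX : GronwallLeakage) :
    TailLeakage a₁ := by
  obtain ⟨C, hC⟩ := hX
  exact ⟨C, fun b a hb hba ↦ hC b a (ha₁.trans_le hb) hba⟩

/-- **Log-AC on the negative side.** If `ε a₁' < 0`... more precisely: on `[b, a] ⊂ (0, ∞)` with `ε b < 0`,
`x ↦ log (-ε x)` is absolutely continuous (`ε` is AC unconditionally, antitone with values in
`(-∞, ε b]`, and `y ↦ log (-y)` is `|ε b|⁻¹`-Lipschitz there). Mirror image of `logAC_of_pos_right`. -/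
theorem logNegAC_of_neg_left {b a : ℝ} (hb : 0 < b) (hba : b ≤ a) (hεb : ε b < 0) :
    AbsolutelyContinuousOnInterval (fun x ↦ Real.log (-ε x)) b a := by
  have hpos : 0 < -ε b := neg_pos.2 hεb
  have hlip : LipschitzOnWith (Real.toNNReal (-ε b)⁻¹) (fun y : ℝ ↦ Real.log (-y)) (Iic (ε b)) := by
    refine LipschitzOnWith.of_dist_le_mul fun x hx y hy ↦ ?_
    show dist (Real.log (-x)) (Real.log (-y)) ≤ _
    rw [Real.coe_toNNReal _ (inv_nonneg.2 hpos.le)]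
    have hx' : -ε b ≤ -x := neg_le_neg hx
    have hy' : -ε b ≤ -y := neg_le_neg hy
    have h := dist_log_le_inv_mul_dist hpos hx' hy'
    rw [dist_neg_neg] at h
    exact h
  have hmaps : MapsTo weilGroundEnergy (uIcc b a) (Iic (ε b)) := by
    intro x hx
    rw [uIcc_of_le hba] at hx
    exact weilGroundEnergy_antitone_of_pos' hb hx.1
  -- (elaborate without expected type: the unifier must not try `?H (ε x) =?= log (-ε x)` by unfolding `ε`)
  have hcomp :=
    (weilGroundEnergy_absolutelyContinuousOnInterval hb hba).comp_of_lipschitzOnWith hlip hmaps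
  beta_reduce at hcomp
  exact hcomp

/-- **The leakage identity on the negative side.** For `0 < b ≤ a` with `ε b < 0` the rate
`C₀ = -(log ∘ (-ε))'` is integrable on `[b, a]` and `ε b · exp (-∫_b^a C₀) = ε a` exactly. So past a
conjugate point the crux's two-window law holds AUTOMATICALLY. -/
theorem leakage_identity_of_neg {b a : ℝ} (hb : 0 < b) (hba : b ≤ a) (hεb : ε b < 0) :
    IntervalIntegrable (fun x ↦ -deriv (fun y ↦ Real.log (-ε y)) x) volume b a ∧
      ε b * Real.exp (-(∫ x in b..a, -deriv (fun y ↦ Real.log (-ε y)) x)) = ε a := by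
  have hAC := logNegAC_of_neg_left hb hba hεb
  have hεa : ε a < 0 := lt_of_le_of_lt (weilGroundEnergy_antitone_of_pos' hb hba) hεb
  refine ⟨hAC.intervalIntegrable_deriv.neg, ?_⟩
  rw [intervalIntegral.integral_neg, neg_neg, hAC.integral_deriv_eq_sub, Real.exp_sub,
    Real.exp_log (neg_pos.2 hεa), Real.exp_log (neg_pos.2 hεb), neg_div_neg_eq,
    mul_div_cancel₀ _ hεb.ne]

/-- **Costume certificate F2.** The tail piece is EXACTLY "head ⟹ RH":
`TailLeakage a₁ ↔ (WeilPositivityOn a₁ → RiemannHypothesis)`.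
(→) is the assembly; (←) if RH then `X` and restrict; if ¬RH then the head fails, so `ε a₁ < 0`,
`ε < 0` on `[a₁, ∞)` and the law holds there with the canonical negative-side rate. -/
theorem tailLeakage_iff_head_imp_rh {a₁ : ℝ} (ha₁ : 0 < a₁) :
    TailLeakage a₁ ↔ (HeadRung a₁ → _root_.RiemannHypothesis) := by
  constructor
  · intro hT hH
    exact gronwallLeakage_iff_riemannHypothesis.1 (gronwallLeakage_of_head_tail ha₁ hH hT)
  · intro h
    by_cases hRH : _root_.RiemannHypothesis
    · exact tailLeakage_of_gronwallLeakage ha₁ (gronwallLeakage_iff_riemannHypothesis.2 hRH)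
    · have hH : ¬ HeadRung a₁ := fun hH ↦ hRH (h hH)
      have hneg : ε a₁ < 0 := by
        by_contra hnn
        push Not at hnn
        exact hH ((weilGroundEnergy_nonneg_iff_holds ha₁).1 hnn)
      refine ⟨fun x ↦ -deriv (fun y ↦ Real.log (-ε y)) x, fun b a hb hba ↦ ?_⟩
      have hb0 : 0 < b := ha₁.trans_le hb
      have hεb : ε b < 0 := lt_of_le_of_lt (weilGroundEnergy_antitone_of_pos' ha₁ hb) hneg
      obtain ⟨hint, heq⟩ := leakage_identity_of_neg hb0 hba hεb
      exact ⟨hint, heq.le⟩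

/-! ## §R Restriction of Weil's criterion to a class `S` of test functions

Generic shape of the Perron–Frobenius (positive cone), parity (even sector) and Sonine/prolate
(Connes) splits: piece 1 says the class `S` reaches the bottom of the form at every window
(RH-free, about WHERE the infimum is attained), piece 2 is Weil positivity on `S` only. -/

/-- Piece 1 (RH-free): at every window, normalised test functions of class `S` come within any `η`
of the energy of any normalised test function. -/
def RestrictionReachesBottom (S : (ℝ → ℂ) → Prop) : Prop :=
  ∀ a : ℝ, 0 < a → ∀ g : ℝ → ℂ, IsWeilTest g → tsupport g ⊆ Icc (-a) a →
    ∫ t, ‖g t‖ ^ 2 = (1 : ℝ) → ∀ η : ℝ, 0 < η →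
      ∃ p : ℝ → ℂ, IsWeilTest p ∧ S p ∧ tsupport p ⊆ Icc (-a) a ∧ ∫ t, ‖p t‖ ^ 2 = (1 : ℝ) ∧
        (weilQuadratic p).re ≤ (weilQuadratic g).re + η

/-- Piece 2: Weil positivity for test functions of class `S` only. -/
def RestrictedWeilPositivity (S : (ℝ → ℂ) → Prop) : Prop :=
  ∀ g : ℝ → ℂ, IsWeilTest g → S g → 0 ≤ (weilQuadratic g).re

/-- **Assembly R (sorry-free):** the two pieces give Weil positivity at every window (normalise a
would-be negative `g`, undercut it by a class-`S` function, contradiction), i.e. item 0098. -/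
theorem uniformWeilPositivity_of_restriction (S : (ℝ → ℂ) → Prop)
    (hB : RestrictionReachesBottom S) (hP : RestrictedWeilPositivity S) :
    UniformWeilPositivity := by
  intro a ha g hg hsupp
  by_contra hneg
  push Not at hneg
  have hN2nn : 0 ≤ ∫ t : ℝ, ‖g t‖ ^ 2 := integral_nonneg fun _ ↦ by positivity
  rcases hN2nn.eq_or_lt with hz | hpos
  · have hg0 : g = 0 := hg.eq_zero_of_integral_norm_sq_eq_zero hz.symm
    subst hg0
    rw [weilQuadratic_zero, Complex.zero_re] at hneg
    exact lt_irrefl _ hneg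
  · set N2 : ℝ := ∫ t : ℝ, ‖g t‖ ^ 2 with hN2
    set c : ℝ := (Real.sqrt N2)⁻¹ with hc
    have hcpos : 0 < c := inv_pos.2 (Real.sqrt_pos.2 hpos)
    have hg't : IsWeilTest fun t ↦ (c : ℂ) * g t := hg.const_mul c
    have hsupp' : tsupport (fun t ↦ (c : ℂ) * g t) ⊆ Icc (-a) a :=
      tsupport_mul_subset_right.trans hsupp
    have hnorm' : ∫ t : ℝ, ‖(c : ℂ) * g t‖ ^ 2 = 1 := by
      simp only [norm_mul, mul_pow, Complex.norm_real, Real.norm_of_nonneg hcpos.le]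
      rw [integral_const_mul, hc, inv_pow, Real.sq_sqrt hN2nn, inv_mul_cancel₀ hpos.ne']
    have hQ' : (weilQuadratic fun t ↦ (c : ℂ) * g t).re = c * c * (weilQuadratic g).re := by
      rw [weilQuadratic_const_mul, Complex.normSq_ofReal, Complex.re_ofReal_mul]
    have hneg' : (weilQuadratic fun t ↦ (c : ℂ) * g t).re < 0 := by
      rw [hQ']
      exact mul_neg_of_pos_of_neg (mul_pos hcpos hcpos) hneg
    set q : ℝ := (weilQuadratic fun t ↦ (c : ℂ) * g t).re with hq
    obtain ⟨p, hp, hSp, -, -, hle⟩ :=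
      hB a ha _ hg't hsupp' hnorm' (-q / 2) (by linarith)
    have h0 : 0 ≤ (weilQuadratic p).re := hP p hp hSp
    linarith

/-- … hence the crux. -/
theorem gronwallLeakage_of_restriction (S : (ℝ → ℂ) → Prop)
    (hB : RestrictionReachesBottom S) (hP : RestrictedWeilPositivity S) : GronwallLeakage :=
  gronwallLeakage_of_uniformWeilPositivity (uniformWeilPositivity_of_restriction S hB hP)

/-! ### §F5 instance: the positive cone (Perron–Frobenius) -/

/-- Pointwise non-negative real test functions. -/
def IsNonnegTest (g : ℝ → ℂ) : Prop := ∀ t : ℝ, (g t).im = 0 ∧ 0 ≤ (g t).re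

/-- Piece 1 of F5: non-negative test functions reach the bottom at every window (a weak, variational
form of "the Weil ground state can be taken ≥ 0"; proved only as `a → 0⁺`, Suzuki arXiv:2606.09096
Thm 1.4; obstructed in general by the polar kernel `2 cosh((x-y)/2) > 0`). RH-free. -/
def PosConeReachesBottom : Prop := RestrictionReachesBottom IsNonnegTest

/-- Piece 2 of F5: Weil positivity on the cone of non-negative test functions. -/
def PosConeWeilPositivity : Prop := RestrictedWeilPositivity IsNonnegTest

theorem gronwallLeakage_of_posCone (hB : PosConeReachesBottom) (hP : PosConeWeilPositivity) :
    GronwallLeakage :=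
  gronwallLeakage_of_restriction IsNonnegTest hB hP

/-- **Costume lemma L1 (Landau), NOT proved here — see STRATEGY-CENSUS.md §L1:** positivity on the
positive cone already gives RH (`Q(g + g(· - x)) = 2Q(g) + 2 Re B_g(x) ≥ 0` bounds the real exponential
sum `Re B_g(x) = Σ_ρ m(ρ) Re (P_g(ρ) e^{(ρ-1/2)x})` from BELOW; Landau's theorem on Laplace transforms of
non-negative functions (Montgomery–Vaughan 2007 Lemma 15.1) + non-real, locally finite exponents force
the fibres with `Re ρ > 1/2` to vanish; a narrow non-negative bump has `P_g(ρ) ≠ 0`). So piece 2 of F5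
is the summit. -/
def PosConeCostume : Prop := PosConeWeilPositivity → _root_.RiemannHypothesis

/-! ### §F4 instance: the even sector (parity) -/

/-- Even test functions. -/
def IsEvenTest (g : ℝ → ℂ) : Prop := ∀ t : ℝ, g (-t) = g t

def EvenSectorReachesBottom : Prop := RestrictionReachesBottom IsEvenTest

def EvenSectorWeilPositivity : Prop := RestrictedWeilPositivity IsEvenTest

theorem gronwallLeakage_of_evenSector (hB : EvenSectorReachesBottom)
    (hP : EvenSectorWeilPositivity) : GronwallLeakage :=
  gronwallLeakage_of_restriction IsEvenTest hB hP

/-- **Costume lemma for F4, NOT proved here — see STRATEGY-CENSUS.md §L1/§F4:** for even `g` the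
symmetrised translate `h_x = (g(·-x) + g(·+x))/2` is even and `Q(h_x) = (Q(g) + Re B_g(2x))/2`, so
even-sector positivity bounds the real exponential sum `Re B_g` from BELOW; Landau's theorem for
Laplace integrals of non-negative functions (Montgomery–Vaughan Lemma 15.1) and the non-real, locally
finite exponents `ρ - 1/2` then force RH exactly as in the positive-cone lemma `PosConeCostume`. -/
def EvenSectorCostume : Prop := EvenSectorWeilPositivity → _root_.RiemannHypothesis

end Summit.RiemannHypothesis.RiemannHypothesis.Cruxes.GronwallLeakage.DecompCensus

end
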